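import Literature.Analysis.FluidPDE.PassiveScalar
import HarnessLib

/-!
# Passive scalar with a source: `∂ₜθ + u·∇θ = κΔθ + s`

Topic: `Literature/Analysis/FluidPDE`. Definition request `defn-IsWeakScalarTransportForcedOn`
(route `AnomalousDissipation/TwoAndHalfD`, item stmt-AnomalousDissipation-0208).

## Content

The forced (inhomogeneous) versions of the accepted notions of `PassiveScalar.lean`:

* `Torus.IsClassicalScalarTransportForcedOn S κ u s θ` — smooth solutions of
  `∂ₜθ + u·∇θ = κΔθ + s`, `div u = 0` on `T^d × S` (same conventions as
  `Torus.IsClassicalScalarTransportOn`: one-sided `timeDerivWithin S`, joint smoothness of `u`,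
  `θ` and now `s` on `S × T^d`).
* `Torus.IsWeakScalarTransportForcedOn T κ u s θ₀ θ` — distributional solutions on `T^d × [0,T)`
  with datum `θ₀`: the conjuncts of `Torus.IsWeakScalarTransportOn` verbatim, plus measurability
  and integrability `s ∈ L¹((0,T) × T^d)` of the source and the source term in the weak identity
  `∫₀ᵀ∫ θ (∂ₜψ + u·∇ψ + κΔψ) + ∫₀ᵀ∫ s ψ + ∫ θ₀ ψ(0) = 0`
  (DEIJ 2022, (1.1) with forcing; Celani et al. 2000, eq. (1): scalar with a steady source in
  2-D turbulence; DiPerna–Lions 1989, §II.1 for the distributional framework).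
* `Torus.IsWeakScalarTransportForced κ u s θ₀ θ` — the global version (`∀ T > 0`).
* `isWeakScalarTransportForcedOn_zero_iff` — with `s = 0` the forced notion is *equivalent* to
  `IsWeakScalarTransportOn` (requested sanity lemma), and likewise classically
  (`isClassicalScalarTransportForcedOn_zero_iff`).

## Sources

* T. Drivas, T. Elgindi, G. Iyer, I.-J. Jeong, *Anomalous dissipation in passive scalar
  transport*, Arch. Ration. Mech. Anal. 243 (2022), 1151–1180, (1.1).
* A. Celani, A. Lanotte, A. Mazzino, M. Vergassola, *Universality and saturation of intermittency
  in passive scalar turbulence*, Phys. Rev. Lett. 84 (2000), 2385–2388, eq. (1) (`∂ₜθ + v·∇θ =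
  κΔθ + f`).
* R. DiPerna, P.-L. Lions, Invent. Math. 98 (1989), §II.1 (weak solutions of transport equations
  with right-hand side).

## Design choices

* The source is `s : ℝ → UnitAddTorus d → ℝ` (time-dependent; a steady source is `fun _ => f`).
  Its standing integrability is `s ∈ L¹((0,T) × T^d)` (so `∫∫ s ψ` is a genuine integral for
  bounded smooth `ψ`), the analogue of the `u θ ∈ L¹` conjunct of the unforced notion.
* Sign convention of the weak identity: testing `∂ₜθ + u·∇θ - κΔθ - s = 0` against `ψ` and
  integrating by parts gives `∫∫ θ(∂ₜψ + u·∇ψ + κΔψ) + ∫∫ s ψ + ∫ θ₀ ψ(0) = 0`.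
-/

noncomputable section

open MeasureTheory Set Topology
open scoped InnerProductSpace ENNReal NNReal

namespace Literature.Analysis.FluidPDE

namespace Torus

variable {d : Type*} [Fintype d] [DecidableEq d]

/-! ## Classical solutions with source -/

section Classical

/-- Classical (smooth) solutions of the forced passive scalar equation
`∂ₜθ + u·∇θ = κ Δθ + s`, `div u = 0` on `T^d × S`, with `u`, `θ`, `s` jointly `C^∞` on
`S × T^d`; conventions of `IsClassicalScalarTransportOn` (one-sided time derivative
`timeDerivWithin S`) (DEIJ 2022, (1.1) with a source; Celani et al. 2000, eq. (1)).
[cite: DEIJ2022, (1.1)] -/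
structure IsClassicalScalarTransportForcedOn (S : Set ℝ) (κ : ℝ)
    (u : ℝ → UnitAddTorus d → EuclideanSpace ℝ d) (s : ℝ → UnitAddTorus d → ℝ)
    (θ : ℝ → UnitAddTorus d → ℝ) : Prop where
  /-- The velocity is jointly smooth on `S × T^d`. -/
  smooth_velocity : FunctionSpaces.Torus.IsSmoothSpaceTimeOn S u
  /-- The source is jointly smooth on `S × T^d`. -/
  smooth_source : FunctionSpaces.Torus.IsSmoothSpaceTimeOn S s
  /-- The scalar is jointly smooth on `S × T^d`. -/
  smooth_scalar : FunctionSpaces.Torus.IsSmoothSpaceTimeOn S θ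
  /-- The equation `∂ₜθ + u·∇θ = κ Δθ + s` holds pointwise on `S × T^d`. -/
  transport : ∀ t ∈ S, ∀ x,
    FunctionSpaces.Torus.timeDerivWithin S θ t x + ⟪u t x, FunctionSpaces.Torus.gradient (θ t) x⟫_ℝ = κ * FunctionSpaces.Torus.laplacian (θ t) x + s t x
  /-- Incompressibility `div u(t) = 0` for `t ∈ S`. -/
  divFree : ∀ t ∈ S, FunctionSpaces.Torus.IsDivFree (u t)

/-- A classical forced solution with source `s = 0` is exactly a classical solution of the
homogeneous equation (the zero function being smooth). [cite: DEIJ2022, (1.1)] -/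
theorem isClassicalScalarTransportForcedOn_zero_iff {S : Set ℝ} {κ : ℝ}
    {u : ℝ → UnitAddTorus d → EuclideanSpace ℝ d} {θ : ℝ → UnitAddTorus d → ℝ}
    (h0 : FunctionSpaces.Torus.IsSmoothSpaceTimeOn S (0 : ℝ → UnitAddTorus d → ℝ)) :
    IsClassicalScalarTransportForcedOn S κ u 0 θ ↔ IsClassicalScalarTransportOn S κ u θ := by
  constructor
  · intro h
    exact ⟨h.smooth_velocity, h.smooth_scalar, fun t ht x => by simpa using h.transport t ht x,
      h.divFree⟩
  · intro h
    exact ⟨h.smooth_velocity, h0, h.smooth_scalar,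
      fun t ht x => by simpa using h.transport t ht x, h.divFree⟩

/-- Forgetting the source equation: a classical forced solution has a smooth, divergence-free
velocity and a smooth scalar (projection API). [cite: DEIJ2022, (1.1)] -/
theorem IsClassicalScalarTransportForcedOn.isSmoothSpaceTimeOn_scalar {S : Set ℝ} {κ : ℝ}
    {u : ℝ → UnitAddTorus d → EuclideanSpace ℝ d} {s θ : ℝ → UnitAddTorus d → ℝ}
    (h : IsClassicalScalarTransportForcedOn S κ u s θ) : FunctionSpaces.Torus.IsSmoothSpaceTimeOn S θ :=
  h.smooth_scalar

end Classical

/-! ## Weak (distributional) solutions with source on `T^d × [0, T)` -/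

section Weak

omit [DecidableEq d] in
/-- Weak (distributional) solutions of the forced passive scalar equation
`∂ₜθ + u·∇θ = κΔθ + s` on `T^d × [0,T)` with initial datum `θ₀`, velocity `u` and source `s`:
the conjuncts of `IsWeakScalarTransportOn` (measurability of `θ`, `u`; `θ ∈ L^∞_t L²_x`;
`u ∈ L¹_t L²_x`; `u θ ∈ L¹_{t,x}`; weak incompressibility a.e. in `t`), plus: `s` is a.e.
strongly measurable and `s ∈ L¹((0,T) × T^d)`, and for every smooth space–time test function `ψ`
vanishing near `t = T` (`IsSpaceTimeTest T ψ`),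
`∫₀ᵀ ∫ θ (∂ₜψ + u·∇ψ + κ Δψ) dx dt + ∫₀ᵀ ∫ s ψ dx dt + ∫ θ₀ ψ(0) dx = 0`
(DiPerna–Lions 1989, §II.1; DEIJ 2022, (1.1) with forcing; Celani et al. 2000, eq. (1)).
[cite: DEIJ2022, (1.1)] -/
structure IsWeakScalarTransportForcedOn (T κ : ℝ) (u : ℝ → UnitAddTorus d → EuclideanSpace ℝ d)
    (s : ℝ → UnitAddTorus d → ℝ) (θ₀ : UnitAddTorus d → ℝ) (θ : ℝ → UnitAddTorus d → ℝ) :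
    Prop where
  /-- `θ` is a.e. strongly measurable on `(0,T) × T^d` (through the space–time lift). -/
  aestronglyMeasurable : AEStronglyMeasurable (FunctionSpaces.Torus.stLift θ) (volume.restrict (Ioo 0 T ×ˢ univ))
  /-- `u` is a.e. strongly measurable on `(0,T) × T^d` (through the space–time lift). -/
  aestronglyMeasurable_velocity :
    AEStronglyMeasurable (FunctionSpaces.Torus.stLift u) (volume.restrict (Ioo 0 T ×ˢ univ))
  /-- `s` is a.e. strongly measurable on `(0,T) × T^d` (through the space–time lift). -/
  aestronglyMeasurable_source :
    AEStronglyMeasurable (FunctionSpaces.Torus.stLift s) (volume.restrict (Ioo 0 T ×ˢ univ))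
  /-- `θ ∈ L^∞(0,T; L²(T^d))`: `∫ |θ(t)|² ≤ C` for a.e. `t ∈ (0,T)`. -/
  ae_lintegral_sq_le : ∃ C : ℝ≥0, ∀ᵐ t ∂(volume.restrict (Ioo 0 T)), ∫⁻ x, ‖θ t x‖ₑ ^ 2 ≤ C
  /-- `u ∈ L¹(0,T; L²(T^d))`: `∫₀ᵀ (∫ ‖u(t)‖²)^{1/2} dt < ∞`. -/
  lintegral_velocity_lt_top :
    ∫⁻ t in Ioo 0 T, (∫⁻ x, ‖u t x‖ₑ ^ 2) ^ (1 / 2 : ℝ) < ∞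
  /-- `u θ ∈ L¹((0,T) × T^d)`. -/
  lintegral_mul_lt_top : ∫⁻ t in Ioo 0 T, ∫⁻ x, ‖u t x‖ₑ * ‖θ t x‖ₑ < ∞
  /-- `s ∈ L¹((0,T) × T^d)`. -/
  lintegral_source_lt_top : ∫⁻ t in Ioo 0 T, ∫⁻ x, ‖s t x‖ₑ < ∞
  /-- `div u(t) = 0` weakly, for a.e. `t ∈ (0,T)`. -/
  ae_isWeaklyDivFree : ∀ᵐ t ∂(volume.restrict (Ioo 0 T)), FunctionSpaces.Torus.IsWeaklyDivFree (u t)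
  /-- The weak formulation with datum and source:
  `∫₀ᵀ ∫ θ (∂ₜψ + u·∇ψ + κΔψ) + ∫₀ᵀ ∫ s ψ + ∫ θ₀ ψ(0) = 0`. -/
  weak_eq : ∀ ψ : ℝ → UnitAddTorus d → ℝ, FunctionSpaces.Torus.IsSpaceTimeTest T ψ →
    (∫ t in Ioo 0 T, ∫ x, θ t x *
        (FunctionSpaces.Torus.timeDeriv ψ t x + ⟪u t x, FunctionSpaces.Torus.gradient (ψ t) x⟫_ℝ + κ * FunctionSpaces.Torus.laplacian (ψ t) x)) +
      (∫ t in Ioo 0 T, ∫ x, s t x * ψ t x) +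
      ∫ x, θ₀ x * ψ 0 x = 0

omit [DecidableEq d] in
/-- Global weak solutions of the forced passive scalar equation on `T^d × [0, ∞)`: weak solutions
on `[0, T)` for every `T > 0`. [cite: DEIJ2022, (1.1)] -/
def IsWeakScalarTransportForced (κ : ℝ) (u : ℝ → UnitAddTorus d → EuclideanSpace ℝ d)
    (s : ℝ → UnitAddTorus d → ℝ) (θ₀ : UnitAddTorus d → ℝ) (θ : ℝ → UnitAddTorus d → ℝ) : Prop :=
  ∀ T : ℝ, 0 < T → IsWeakScalarTransportForcedOn T κ u s θ₀ θ

variable {T κ : ℝ} {u : ℝ → UnitAddTorus d → EuclideanSpace ℝ d} {s : ℝ → UnitAddTorus d → ℝ}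
  {θ₀ : UnitAddTorus d → ℝ} {θ : ℝ → UnitAddTorus d → ℝ}

omit [DecidableEq d] in
/-- **`s = 0` recovers the homogeneous notion**: a weak solution of the forced equation with zero
source is exactly a weak solution in the sense of `IsWeakScalarTransportOn` (the extra conjuncts
are trivially satisfied by `s = 0` and the source term `∫∫ 0 · ψ` vanishes).
[cite: DEIJ2022, (1.1)] -/
theorem isWeakScalarTransportForcedOn_zero_iff :
    IsWeakScalarTransportForcedOn T κ u 0 θ₀ θ ↔ IsWeakScalarTransportOn T κ u θ₀ θ := by
  constructor
  · intro h
    refine ⟨h.aestronglyMeasurable, h.aestronglyMeasurable_velocity, h.ae_lintegral_sq_le,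
      h.lintegral_velocity_lt_top, h.lintegral_mul_lt_top, h.ae_isWeaklyDivFree, fun ψ hψ => ?_⟩
    simpa using h.weak_eq ψ hψ
  · intro h
    refine ⟨h.aestronglyMeasurable, h.aestronglyMeasurable_velocity, ?_, h.ae_lintegral_sq_le,
      h.lintegral_velocity_lt_top, h.lintegral_mul_lt_top, by simp, h.ae_isWeaklyDivFree,
      fun ψ hψ => ?_⟩
    · exact aestronglyMeasurable_const (b := (0 : ℝ))
    · simpa using h.weak_eq ψ hψ

omit [DecidableEq d] in
/-- The global forced notion at each finite horizon. [cite: DEIJ2022, (1.1)] -/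
theorem IsWeakScalarTransportForced.on (h : IsWeakScalarTransportForced κ u s θ₀ θ) (hT : 0 < T) :
    IsWeakScalarTransportForcedOn T κ u s θ₀ θ :=
  h T hT

end Weak

end Torus

end Literature.Analysis.FluidPDE

end
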